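import Summits.HodgeConjecture.HodgeConjecture.Theorems.Ring2AbelianAllTypeIIIFourfolds
import Summits.HodgeConjecture.HodgeConjecture.Theorems.Ring2AbelianAllWeilSignature
import Summits.HodgeConjecture.HodgeConjecture.Theorems.Ring2AbelianAllWeilDiscriminantDescent
import Literature.AlgebraicGeometry.VanGeemen1994.HyperbolicOfSplitDiscriminant
import Literature.AlgebraicGeometry.VanGeemen1994.WeilDiscriminantOfProductTop
import Literature.AlgebraicGeometry.VanGeemen1994.WeilKFrame
import Literature.AlgebraicGeometry.Motives.SegreHyperplaneClassProdCurve
import Literature.AlgebraicGeometry.Motives.AimedSplitProductDischarge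
import Literature.AlgebraicGeometry.HodgeTheory.WeilSurfaceCMSquareModel
import HarnessLib

/-!
# Ring 2 · AbelianAll (seat `ab-weil-2`, gen 3) — the Weil-type products `X₂ × E_k` (Moonen–Zarhin 1999
  Thm. 0.1 (a)) carry a discriminant-1 Weil structure; all their powers satisfy HC modulo Floccari–Fu alone

HONEST FRAMING (sub-cell `pub-hodge-ring2-ab-*`, verbatim): research route, not a corollary; conditional on HC_CM plus
one named minimal statement. (Cell `pub-hodge-ring2`, verbatim: research route conditional on HC_CM; not a corollary;
Q11.4-sentence-2 already refuted in dim ≥ 3.) `HC_CM` does not occur here. No definition, no named fact, no `sorry`; the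
one printed input is the refereed NAMED FACT `HodgeTheory.FloccariFu2026_hodgeClasses_algebraic_powers_discOneWeilFourfold`
(binder `h5`, never asserted), and only in §2.

THE CELL. The non-simple members of the atlas cell `Ring2.Atlas.HodgePowersOfWeilTypeFourfold` (atlas-1,
`Theorems/Ring2AtlasOpenCells.lean`; rows g4.(a1)/(a2) `E_k × X₂` of AV-HODGE-ATLAS, MZ99 Thm. 0.1 case (a): `X ~ X₁ × X₂`,
`X₁` an elliptic curve with CM by `k = ℚ(√-d)`, `X₂` an abelian threefold with `k ↪ End⁰(X₂)`, `k` acting on `T₀X` with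
multiplicities `(2,2)`). The atlas docstring records their print status as "(γ) … covered by (α) [Floccari–Fu] — … and
[DERIVED here, elementary, not stated in print] a product polarization `a·L_E ⊠ b·L₂` has Weil discriminant
`a·b³·δ(E_k)·δ(X₂)`, so a suitable `(a, b)` gives discriminant `1` (rank 4, signature `(2,2)`, `det ≡ 1` ⟹ hyperbolic,
Landherr)". THIS FILE MAKES THAT DERIVED STEP A KERNEL THEOREM: `hasDiscOneWeilStructure_threefold_prod_curve`.

THE PROOF (all inputs are tree theorems; no named fact in §1). For `(Y, φ)` a threefold and `(E, ψ)` a curve with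
`φ² = ψ² = -d`, and `(Y × E, φ × ψ)` of Weil type `(2,2)`:
(1) the `K`-symmetric weighted Segre embeddings `e_m` of `Y × E` with `e_m^* a = pr_Y^* h_Y⁰ + s·m·pr_E^* η₀`,
`φ^* h_Y⁰ = d h_Y⁰` (`Motives.exists_symmetricSegreEmbedding_prodCurve`), so `h_K(e_m) = pr_Y^* h_K^Y + (2dsm)·pr_E^* η₀`;
(2) a `K`-frame of `H¹(Y)` for `h_K^Y` with Gram determinant `q_Y ∈ ℚˣ` and top coefficient `t_Y`
(`VanGeemen1994.exists_kFrame_ksymm`, van Geemen 5.2 (2)–(3) in odd `K`-rank) and the frame `(v, ψ^*v)` of `H¹(E)`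
(`HodgeTheory.cmCurve_rationalModel`); (3) the product witness (`VanGeemen1994.hasWeilDiscriminantNondeg_prod_of_kFrames`,
"`det H` is multiplicative"): `h_K(e_m)` has discriminant class `[(3·2dsm)³ · t_Y · q_Y] = [m³ · C]`, the weights being
non-zero by `VanGeemen1994.prod_kFrames_top_ne_zero`; (4) `C > 0` by van Geemen 5.2 (4) on the carriers (ab-weil-1's
`weilSign_eq_of_hasWeilDiscriminantNondeg`, at `m = 1`); (5) for `m = |num C| · den C` the class `[m³C] = [(m·num C)²]` is
trivial; (6) Landherr's converse on the carriers (`VanGeemen1994.isHyperbolicWeilType_of_hasWeilDiscriminantNondeg_split`,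
this seat gen 3) makes `(Y × E, φ × ψ)` HYPERBOLIC for `h_K(e_m)` — `HasDiscOneWeilStructure (Y × E)`.
§2: Floccari–Fu ⟹ HC for every power of `Y × E` (and of anything isogenous to a power, e.g. `E × Y`).

## References

* [MoonenZarhin1999LowDim] B. Moonen, Yu. Zarhin, Math. Ann. 315 (1999) = arXiv:math/9901113, Thm. 0.1 (a) and (1).
* [vanGeemen1994HodgeAV] B. van Geemen, LNM 1594 (1994), Lemma 5.2 (2)–(4), 5.4 and (5.4.1).
* [FloccariFu2026] S. Floccari, L. Fu, J. Math. Pures Appl. 210 (2026) 103876, Thm. 1.2.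
* [Landherr1936HermitianForms] W. Landherr, Abh. Math. Sem. Hamburg 11 (1936) 245–248.
* [Markman2025SurveySecant] E. Markman, arXiv:2509.23403, §11.5 Step 2 (product polarizations and discriminants).
-/

set_option linter.dupNamespace false

noncomputable section

open CategoryTheory

namespace Summit.HodgeConjecture.HodgeConjecture.Ring2.AbelianAll

open Literature.AlgebraicGeometry Literature.AlgebraicGeometry.Motives
open Literature.AlgebraicGeometry.HodgeTheory Literature.AlgebraicGeometry.VanGeemen1994
open Literature.AlgebraicTopology.SingularHomology
open Literature.Geometry.Kaehler
open Summit.HodgeConjecture.HodgeConjecture.Theses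

/-! ## §1 The discriminant-1 Weil structure on `Y × E` -/

/-- **Moonen–Zarhin's case (a) products carry a discriminant-1 Weil structure** (MZ99 Thm. 0.1 (a); the
DERIVED step "(γ)" of the atlas cell `HodgePowersOfWeilTypeFourfold`, now a theorem). Let `Y` be a complex abelian
threefold and `E` an elliptic curve with endomorphisms `φ`, `ψ`, `φ ≫ φ = -(d • 𝟙)`, `ψ ≫ ψ = -(d • 𝟙)` (`d ≥ 1`), such
that `(Y × E, φ × ψ)` is of Weil type `(2, 2)` (`HodgeTheory.IsWeilType`; e.g. `k` acts on `T₀Y` with multiplicities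
`(1, 2)` and on `T₀E` by the given embedding). Then `Y × E` carries a polarized Weil structure of discriminant `1`
(`HasDiscOneWeilStructure`: a `K`-symmetrised hyperplane class for which `(Y × E, φ × ψ)` is HYPERBOLIC) — namely the
weighted Segre polarization `L_Y ⊠ L_E^{⊗m}` for a suitable weight `m`, by the product discriminant
`[m³ · C]`, the sign `C > 0` (van Geemen 5.2 (4)) and Landherr's converse. No named fact.
[cite: MoonenZarhin1999LowDim, Thm. 0.1 (a)] [cite: vanGeemen1994HodgeAV, Lemma 5.2 (2)–(4), 5.4 and (5.4.1)]
[cite: Landherr1936HermitianForms] -/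
theorem hasDiscOneWeilStructure_threefold_prod_curve {Y E : AbelianVariety ℂ} (hY : Y.dim = 3) (hE : E.dim = 1)
    {d : ℕ} (hd : 0 < d) {φ : Y ⟶ Y} {ψ : E ⟶ E} (hφ : φ ≫ φ = -(d • 𝟙 Y)) (hψ : ψ ≫ ψ = -(d • 𝟙 E))
    (hW : IsWeilType (Y.prod E)
      (AbelianVariety.prodLift (AbelianVariety.fst Y E ≫ φ) (AbelianVariety.snd Y E ≫ ψ)) 2 d) :
    HasDiscOneWeilStructure (Y.prod E) := by
  classical
  set Φ := AbelianVariety.prodLift (AbelianVariety.fst Y E ≫ φ) (AbelianVariety.snd Y E ≫ ψ) with hΦ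
  have hΦ2 : Φ ≫ Φ = -(d • 𝟙 (Y.prod E)) := prodLift_comp_self_eq_neg_nsmul hφ hψ
  have hY' : Y.dim = 2 + 1 := by rw [hY]
  have hE' : E.dim = 0 + 1 := by rw [hE]
  have hP4 : (Y.prod E).dim = 2 * 2 := by rw [AbelianVariety.dim_prod, hY, hE]
  have hdQ : (0 : ℚ) < d := by exact_mod_cast hd
  -- (1) the curve: frame `(v, ψ^* v)`, reference class `η₀ = v ∪ ψ^*v`
  obtain ⟨u, η₀, hur, hui, -, hMu, -, hη₀r, hη₀0, hgram, -, hψ2, -⟩ := cmCurve_rationalModel hE hd hψ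
  change complexBetti E.X 2 at η₀
  have hψη : complexBetti.map ψ.hom.hom.hom 2 η₀ = (d : ℂ) • η₀ := hψ2 η₀
  have hu1 : complexBetti.map ψ.hom.hom.hom 1 (u 0) = u 1 := by
    rw [hMu 0, Fin.sum_univ_two]
    simp
  set xB : Fin 1 → complexBetti E.X 1 := fun _ => u 0 with hxB
  have hxBr : ∀ i, IsRationalClass (xB i) := fun _ => hur 0
  have hiB : LinearIndependent ℂ (Sum.elim xB (fun i => complexBetti.map ψ.hom.hom.hom 1 (xB i))) := by
    let ι₂ : Fin 1 ⊕ Fin 1 → Fin 2 := Sum.elim (fun _ => 0) (fun _ => 1)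
    have hι₂ : Function.Injective ι₂ := by
      rintro (i | i) (j | j) h
      · rw [Subsingleton.elim i j]
      · exact absurd h (by simp [ι₂])
      · exact absurd h (by simp [ι₂])
      · rw [Subsingleton.elim i j]
    have heq : Sum.elim xB (fun i => complexBetti.map ψ.hom.hom.hom 1 (xB i)) = u ∘ ι₂ := by
      funext s
      rcases s with i | i
      · rfl
      · simp only [Sum.elim_inr, Function.comp_apply, ι₂, hxB, hu1]
    rw [heq]
    exact hui.comp ι₂ hι₂
  set aB : Matrix (Fin 1) (Fin 1) ℚ := fun _ _ => 1 with haB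
  set bB : Matrix (Fin 1) (Fin 1) ℚ := fun _ _ => 0 with hbB
  have hpB : ∀ (c : ℚ) (i j : Fin 1),
      polarizationPairingOne E.X (((c : ℚ) : ℂ) • η₀) 0 (xB i) (complexBetti.map ψ.hom.hom.hom 1 (xB j)) =
          ((aB i j : ℚ) : ℂ) • η₀ ∧
        polarizationPairingOne E.X (((c : ℚ) : ℂ) • η₀) 0 (xB i) (xB j) = ((bB i j : ℚ) : ℂ) • η₀ := by
    intro c i j
    refine ⟨?_, ?_⟩
    · simp only [hxB, haB, hu1]
      rw [hgram]
      simp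
    · simp only [hxB, hbB]
      rw [hgram]
      simp
  have hqB : (weilGramMatrix d aB bB).det = algebraMap ℚ (weilField d) ((1 : ℚˣ) : ℚ) := by
    rw [Matrix.det_unique, weilGramMatrix_apply]
    simp [haB, hbB]
  -- (2) the symmetric Segre data of `Y` and the `K`-frame of `(Y, φ, h_K^Y)`
  obtain ⟨eY, aY, s, haY, haY0, hsym, hemb⟩ := exists_symmetricSegreEmbedding_prodCurve hd hφ E hE η₀ hη₀r hη₀0
  obtain ⟨xA, ωA, aA, bA, qA, tA, hxA, hiA, hωA, hωA0, hpA, hqA, htA⟩ :=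
    exists_kFrame_ksymm (m := 2) (by norm_num) hY' hd hφ eY haY haY0
  set hKY := (d : ℂ) • complexBetti.map eY.ι 2 aY + complexBetti.map φ.hom.hom.hom 2 (complexBetti.map eY.ι 2 aY)
    with hKYdef
  -- the `K`-symmetrised class of the weighted Segre embedding is the product class
  have hKP : ∀ (m : ℕ) (e : ProjectiveEmbedding (Y.prod E).X) (a : complexBetti (projectiveSpace e.n ℂ) 2),
      complexBetti.map e.ι 2 a =
        complexBetti.map (AbelianVariety.fst Y E).hom.hom.hom 2 (complexBetti.map eY.ι 2 aY) +
          ((s * m : ℚ) : ℂ) • complexBetti.map (AbelianVariety.snd Y E).hom.hom.hom 2 η₀ →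
      (d : ℂ) • complexBetti.map e.ι 2 a + complexBetti.map Φ.hom.hom.hom 2 (complexBetti.map e.ι 2 a) =
        complexBetti.map (AbelianVariety.fst Y E).hom.hom.hom 2 hKY +
          complexBetti.map (AbelianVariety.snd Y E).hom.hom.hom 2 ((((2 * d * s * m : ℚ)) : ℂ) • η₀) := by
    intro m e a he
    rw [he, map_add, map_smul, map_prodLift_map_fst φ ψ 2, map_prodLift_map_snd φ ψ 2, hψη, hKYdef, map_add,
      map_smul, map_smul, map_smul]
    simp only [smul_add, smul_smul]
    push_cast
    module
  -- (3) the product witness of weight `m`, with its non-vanishing weights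
  have hN : 2 * 2 = 2 + 0 + 2 := by norm_num
  let ε : Fin (2 + 1) ⊕ Fin 1 ≃ Fin (2 * 2) := finSumFinEquiv.trans (finCongr (by norm_num))
  have witness : ∀ m : ℕ, 0 < m → ∃ (e : ProjectiveEmbedding (Y.prod E).X) (a : complexBetti (projectiveSpace e.n ℂ) 2)
      (w : ℚˣ), IsRationalClass a ∧ a ≠ 0 ∧
        (w : ℚ) = (((2 * 2 - 1).choose 2 : ℚ) * (2 * d * s * m)) ^ (2 + 1) * ((((2 * 2 - 1).choose (2 + 1) : ℚ)) * tA) ^ 1 * qA ∧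
        HasWeilDiscriminantNondeg (Y.prod E) Φ 2 d
          ((d : ℂ) • complexBetti.map e.ι 2 a + complexBetti.map Φ.hom.hom.hom 2 (complexBetti.map e.ι 2 a))
          (QuotientGroup.mk w) := by
    intro m hm
    obtain ⟨e, a, ha, ha0, he⟩ := hemb m hm
    have hh := hKP m e a he
    obtain ⟨htA0, hc0⟩ := prod_kFrames_top_ne_zero hY' hE' hN (kA := 2 + 1) (kB := 1) (by norm_num) (by norm_num)
      (by norm_num) hd hφ hψ xA hxA hiA hKY ωA aA bA hpA tA htA xB hxBr hiB ((((2 * d * s * m : ℚ)) : ℂ) • η₀) η₀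
      aB bB (hpB _) (2 * d * s * m) (af_top_curve η₀ _) e ha ha0 hh
    have hδ := hasWeilDiscriminantNondeg_prod_of_kFrames hY' hE' hN ε xA hxA hiA hKY ωA hωA hωA0 aA bA hpA tA htA
      htA0 qA hqA xB hxBr hiB ((((2 * d * s * m : ℚ)) : ℂ) • η₀) η₀ hη₀r hη₀0 aB bB (hpB _) (2 * d * s * m)
      (af_top_curve η₀ _) hc0 1 hqB
    rw [← hh] at hδ
    refine ⟨e, a, _, ha, ha0, ?_, hδ⟩
    rw [Units.val_mul, Units.val_mul, Units.val_mk0, Units.val_one, mul_one]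
  -- numerics of the binomial weights
  have hc32 : ((2 * 2 - 1).choose 2 : ℚ) = 3 := by norm_num [Nat.choose]
  have hc33 : ((2 * 2 - 1).choose (2 + 1) : ℚ) = 1 := by norm_num [Nat.choose]
  -- (4) the sign at weight 1: `C = (6ds)³ · t_Y · q_Y > 0`
  obtain ⟨e₁, a₁, w₁, ha₁, ha₁0, hw₁, hδ₁⟩ := witness 1 one_pos
  have hsign := weilSign_eq_of_hasWeilDiscriminantNondeg hW e₁ ha₁ ha₁0 hδ₁
  rw [weilSign_mk_eq_neg_one_pow_iff] at hsign
  set C : ℚ := (3 * (2 * d * s)) ^ 3 * tA * qA with hC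
  have hw₁C : (w₁ : ℚ) = C := by
    rw [hw₁, hc32, hc33, hC]
    push_cast
    ring
  have hCpos : 0 < C := by
    rw [← hw₁C]
    simpa using hsign
  -- (5) the weight `m = |num C| · den C`: `m · C = (num C)²`
  set m : ℕ := C.num.natAbs * C.den with hmdef
  have hnum : 0 < C.num := Rat.num_pos.2 hCpos
  have hm : 0 < m := Nat.mul_pos (Int.natAbs_pos.2 hnum.ne') C.den_pos
  have hmC : (m : ℚ) * C = (C.num : ℚ) ^ 2 := by
    have h1 : ((C.num.natAbs : ℕ) : ℚ) = (C.num : ℚ) := by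
      rw [← Int.cast_natCast, Int.natAbs_of_nonneg hnum.le]
    rw [hmdef, Nat.cast_mul, h1, mul_assoc, Rat.den_mul_eq_num, sq]
  obtain ⟨e, a, w, ha, ha0, hw, hδ⟩ := witness m hm
  have hwval : (w : ℚ) = ((m : ℚ) * C.num) ^ 2 := by
    have h2 : (w : ℚ) = (m : ℚ) ^ 3 * C := by
      rw [hw, hc32, hc33, hC]
      push_cast
      ring
    rw [h2, pow_succ, mul_assoc, hmC]
    ring
  have hmn0 : (m : ℚ) * C.num ≠ 0 := mul_ne_zero (by exact_mod_cast hm.ne') (by exact_mod_cast hnum.ne')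
  have hwsq : w = Units.mk0 ((m : ℚ) * C.num) hmn0 ^ 2 := Units.ext (by rw [hwval, Units.val_pow_eq_pow_val, Units.val_mk0])
  have hclass : (QuotientGroup.mk w : weilNormResidueGroup d) = QuotientGroup.mk ((-1 : ℚˣ) ^ 2) := by
    rw [neg_one_sq, QuotientGroup.mk_one, hwsq, QuotientGroup.eq_one_iff]
    have h := pow_finrank_mem_normUnitsSubgroup (F := ℚ) (K := weilField d) (Units.mk0 ((m : ℚ) * C.num) hmn0)
    rwa [finrank_weilField] at h
  rw [hclass] at hδ
  -- (6) Landherr's converse on the carriers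
  obtain ⟨c, hcw, hc0, hcr⟩ := exists_isRationalClass_ne_zero_mem_weilClassesOf hW.pos hW.dim_eq hW.d_pos hW.sq_eq
  exact ⟨Φ, d, e, a, hd, hΦ2, ha, ha0,
    isHyperbolicWeilType_of_hasWeilDiscriminantNondeg_split two_pos hP4 hd hΦ2 e ha ha0
      ⟨c, hcw, hcr, hW.isOfHodgeType_of_mem_weilClassesOf hcw, hc0⟩ hδ⟩

/-! ## §2 Floccari–Fu: HC for all powers of `Y × E` -/

/-- **HC for ALL POWERS of the Weil-type products `X₂ × E_k` (MZ99 Thm. 0.1 (a)), modulo the refereed named fact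
Floccari–Fu 2026 Thm. 1.2 ALONE** (binder `h5`; `HC_CM` absent, no Markman, no Landherr binder — Landherr is a tree
theorem): §1 + the tree's `hodgeConjectureFor_powSucc_of_floccariFu_of_hasDiscOneWeilStructure`.
[cite: FloccariFu2026, Theorem 1.2] [cite: MoonenZarhin1999LowDim, Thm. 0.1 (a) and (1)] -/
theorem hodgeConjectureFor_powSucc_threefold_prod_curve_of_floccariFu
    (h5 : FloccariFu2026_hodgeClasses_algebraic_powers_discOneWeilFourfold)
    {Y E : AbelianVariety ℂ} (hY : Y.dim = 3) (hE : E.dim = 1) {d : ℕ} (hd : 0 < d) {φ : Y ⟶ Y} {ψ : E ⟶ E}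
    (hφ : φ ≫ φ = -(d • 𝟙 Y)) (hψ : ψ ≫ ψ = -(d • 𝟙 E))
    (hW : IsWeilType (Y.prod E)
      (AbelianVariety.prodLift (AbelianVariety.fst Y E ≫ φ) (AbelianVariety.snd Y E ≫ ψ)) 2 d) (N : ℕ) :
    HodgeConjectureFor ((Y.prod E).powSucc N).dim ((Y.prod E).powSucc N).X :=
  hodgeConjectureFor_powSucc_of_floccariFu_of_hasDiscOneWeilStructure h5 (Y.prod E)
    (by rw [AbelianVariety.dim_prod, hY, hE]) (hasDiscOneWeilStructure_threefold_prod_curve hY hE hd hφ hψ hW) N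

/-- **The same for every abelian variety ISOGENOUS to a power of `Y × E`** (e.g. `E × Y`, `(E × Y)ⁿ`): HC is
isogeny-invariant (`HodgeConjectureFor.of_isIsogenous`). [cite: FloccariFu2026, Theorem 1.2]
[cite: MoonenZarhin1999LowDim, Thm. 0.1 (a)] -/
theorem hodgeConjectureFor_of_isIsogenous_powSucc_threefold_prod_curve_of_floccariFu
    (h5 : FloccariFu2026_hodgeClasses_algebraic_powers_discOneWeilFourfold)
    {Y E B : AbelianVariety ℂ} (hY : Y.dim = 3) (hE : E.dim = 1) {d : ℕ} (hd : 0 < d) {φ : Y ⟶ Y} {ψ : E ⟶ E}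
    (hφ : φ ≫ φ = -(d • 𝟙 Y)) (hψ : ψ ≫ ψ = -(d • 𝟙 E))
    (hW : IsWeilType (Y.prod E)
      (AbelianVariety.prodLift (AbelianVariety.fst Y E ≫ φ) (AbelianVariety.snd Y E ≫ ψ)) 2 d) {N : ℕ}
    (hB : AbelianVariety.IsIsogenous B ((Y.prod E).powSucc N)) : HodgeConjectureFor B.dim B.X :=
  hodgeConjectureFor_of_isIsogenous_powSucc_of_floccariFu_of_hasDiscOneWeilStructure h5
    (by rw [AbelianVariety.dim_prod, hY, hE]) (hasDiscOneWeilStructure_threefold_prod_curve hY hE hd hφ hψ hW) hB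

/-- **The case-(a) sub-cell of `HodgePowersOfWeilTypeFourfold`, closed modulo Floccari–Fu** (the cell's binders:
`dim X = 4`, `φ_X ≫ φ_X = -d`, every Weil class of type `(2,2)` — here for `X = Y × E` with the product structure).
[cite: MoonenZarhin1999LowDim, Thm. 0.1 (a) and (1)] [cite: FloccariFu2026, Theorem 1.2] -/
theorem hodgePowers_threefold_prod_curve_of_floccariFu
    (h5 : FloccariFu2026_hodgeClasses_algebraic_powers_discOneWeilFourfold)
    {Y E : AbelianVariety ℂ} (hY : Y.dim = 3) (hE : E.dim = 1) {d : ℕ} (hd : 0 < d) {φ : Y ⟶ Y} {ψ : E ⟶ E}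
    (hφ : φ ≫ φ = -(d • 𝟙 Y)) (hψ : ψ ≫ ψ = -(d • 𝟙 E))
    (hWc : ∀ c ∈ weilClassesOf (Y.prod E)
      (AbelianVariety.prodLift (AbelianVariety.fst Y E ≫ φ) (AbelianVariety.snd Y E ≫ ψ)) 2 d,
      IsOfHodgeType 4 (Y.prod E).X 4 2 2 c) (N : ℕ) :
    HodgeConjectureFor ((Y.prod E).powSucc N).dim ((Y.prod E).powSucc N).X :=
  hodgeConjectureFor_powSucc_threefold_prod_curve_of_floccariFu h5 hY hE hd hφ hψ
    (isWeilType_iff_weilPlane.2 ⟨two_pos, hd, by rw [AbelianVariety.dim_prod, hY, hE],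
      prodLift_comp_self_eq_neg_nsmul hφ hψ, hWc⟩) N

end Summit.HodgeConjecture.HodgeConjecture.Ring2.AbelianAll

end
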